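import Summits.CriticalPhenomena.SAWScalingLimit.Theorems.SAWDevelopingMapHexConjectureAvoidanceCocycleAssembly
import Summits.CriticalPhenomena.SAWScalingLimit.Theorems.SAWDevelopingMapHexConjectureAvoidanceCocycleValue
import Summits.CriticalPhenomena.SAWScalingLimit.Theorems.SAWDevelopingMapObservableToSLECanonicalTransferReductionHA
import Summits.CriticalPhenomena.SAWScalingLimit.Theorems.SAWDevelopingMapObservableToSLECanonicalTransferAssembly
import Summits.CriticalPhenomena.SAWScalingLimit.Theorems.SAWDevelopingMapObservableToSLEChordalCarrierLimits
import Summits.CriticalPhenomena.SAWScalingLimit.Theorems.SAWChargeContinuationAvoidanceOfLimit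
import Literature.Probability.RandomPlanarGeometry.CaratheodoryHalfPlaneProofs
import Literature.Probability.RandomPlanarGeometry.EmbSAWLawSums
import Literature.Probability.RandomPlanarGeometry.HexSAWVirginizationCut
import HarnessLib

/-!
# Crux `HexConjecture` (stmt-CriticalPhenomena-0808), line `root-locality-replaces-loewner`,
stub `stub_avoidanceCocycle`: the stub modulo the canonical transfer, and its FLOOR-CLASS reach

Landing target:
`Summits/CriticalPhenomena/SAWScalingLimit/Theorems/SAWDevelopingMapHexConjectureAvoidanceCocycle.lean`
(`--supports stmt-CriticalPhenomena-0808`).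

* `avoidanceCocycle_of_canonicalTransfer`: the registered stub `stub_avoidanceCocycle`
  (`ObservableLimit → RootDominance → HexAvoidanceCocycle`) holds GIVEN the canonical transfer of
  the flat-boundary class, `CanonicalTransfer♭ : AdmissibleRestrictionLimit♭ → FloorRestrictionLimit♭`
  (for the canonical law `hexSAWLaw` with discrete-boundary endpoints the probability of
  `{range ⊆ closure D'}` tends to `Φ_A'(0)^{5/8}` once the admissible restriction cocycle does), by
  steps (a)+(b) (`restrictionLimit_of_rootDominance`, `…CocycleAssembly`) and (c)
  (`measure_rangeSubset_closure_eq_of_isSLELaw`, `…CocycleValue`).  `CanonicalTransfer♭` is the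
  precise missing input (d) of the stub: its floor-class analogue is crux
  stmt-CriticalPhenomena-10472's `canonicalTransfer_of_hullApprox` (landed) modulo the registered
  continuum input `stub_hullApproxDomain`; the flat-boundary class needs that lattice topology
  redone without the floor hypothesis `im a = im b ∧ D ⊆ {im > im a}`.
* `admissibleRestrictionLimit_of_rootDominance`: crux-10472's `AdmissibleRestrictionLimit` from
  ROOT DOMINANCE instead of short-chord locality (specialisation of the flat-class cocycle).
* `hexAvoidanceCocycle_floor_of_hullApprox`: for FLOOR domains and discrete-boundary canonical
  endpoints, `HexObservableLimitR → RootDominance → (HA) →` the conclusion of `HexAvoidanceCocycle`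
  — the landed `canonicalTransfer_of_hullApprox` under (HA), the discrete-boundary endpoints being
  floor vertices inside the flat balls (`stub_avoidanceCocycle_floorEndpoint`), and the sandwich
  `mesh(D') ⊆ {range ⊆ closure D'} ⊆ mesh(D'')` for the (HA)-super-domains `D'' ⊇ collar(D')`
  with `Φ_{A''}'(0)^{5/8} ≤ (1 + ε) Φ_A'(0)^{5/8}`.  In the floor class the only missing input of
  the stub is therefore 10472's registered open sub-goal `stub_hullApproxDomain`.
-/

noncomputable section

open scoped Topology NNReal ENNReal
open Filter Set Metric MeasureTheory
open Literature.Probability.LatticeModels (HexVertex hexGraph hexCenter)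
open Literature.Probability.RandomPlanarGeometry
open Literature.Probability.RandomPlanarGeometry.SAW
open UpperHalfPlane (upperHalfPlaneSet)
open Summit.CriticalPhenomena.SAWScalingLimit.Theorems.ObservableToSLE.FloorRatio
  (canonicalTransfer_of_hullApprox eventually_adj_mem_ball mem_of_floor segment_subset_of_floor
    curve_mem_rangeSubset_of_meshWalk eventually_ne_of_tendsto_hexCenter)
open Summit.CriticalPhenomena.SAWScalingLimit.Theorems.ObservableToSLE.Negative
  (eventually_isProbabilityMeasure_hexSAWLaw)
open Summit.CriticalPhenomena.SAWScalingLimit.Theorems.AvoidanceOfLimit (segment_subset_range_toCurve)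
open Summit.CriticalPhenomena.SAWScalingLimit.Theorems.HexConjecture.RootLocality.Cocycle
  (restrictionLimit_of_rootDominance measure_rangeSubset_closure_eq_of_isSLELaw
    tendsto_of_eventually_between)

namespace Summit.CriticalPhenomena.SAWScalingLimit.Theorems.HexConjecture.RootLocality


open Summit.CriticalPhenomena.SAWScalingLimit.Theorems.HexConjecture.RootLocality.Cocycle
  (restrictionLimit_of_rootDominance measure_rangeSubset_closure_eq_of_isSLELaw)

/-- **Registered helper `stub_avoidanceCocycle_restrictionData`** (crux item stmt-CriticalPhenomena-0808,
line `root-locality-replaces-loewner`, stub `stub_avoidanceCocycle`): every hull subdomain of a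
Dobrushin domain carries restriction data — a chordal uniformizing map `φ` (Riemann + Carathéodory,
`MarkedDomain.exists_isChordalUniformizing_holds`), the restriction map `Φ_A` of the pulled-back
`*`-hull and its derivative number `d = Φ_A'(0) ∈ (0, 1]` ([LSW] §2 (2.4)).
[cite: LawlerSchrammWerner2003Restriction, §2 (2.4) p. 7] -/
theorem stub_avoidanceCocycle_restrictionData : ∀ (D D' : Literature.Probability.RandomPlanarGeometry.DobrushinDomain), D.IsHullSubdomain D' → ∃ (φ : Literature.Probability.RandomPlanarGeometry.ConformalEquiv UpperHalfPlane.upperHalfPlaneSet D.carrier) (Φ : Literature.Probability.RandomPlanarGeometry.ConformalEquiv (UpperHalfPlane.upperHalfPlaneSet \ φ.pullbackHull D') UpperHalfPlane.upperHalfPlaneSet) (d : ℝ), D.IsChordalUniformizing φ ∧ Literature.Probability.RandomPlanarGeometry.IsRestrictionMap (φ.pullbackHull D') Φ ∧ Literature.Probability.RandomPlanarGeometry.HasRestrictionDeriv (φ.pullbackHull D') Φ d ∧ 0 < d ∧ d ≤ 1 := by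
  intro D D' hD'
  obtain ⟨φ, hφ⟩ := MarkedDomain.exists_isChordalUniformizing_holds D
  have hA : IsStarHull (φ.pullbackHull D') :=
    IsStarHull.pullbackHull JordanDomain.isSimplyConnected_holds hφ hD'
  obtain ⟨Φ, hΦ, -⟩ := IsStarHull.existsUnique_isRestrictionMap_holds hA
  obtain ⟨d, hd0, hd1, hd⟩ := IsStarHull.exists_hasRestrictionDeriv_holds hA hΦ
  exact ⟨φ, Φ, d, hφ, hΦ, hd, hd0, hd1⟩

/-- **The stub modulo the canonical transfer**: `HexObservableLimitR → RootDominance →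
CanonicalTransfer♭ → HexAvoidanceCocycle` (the registered statement of `stub_avoidanceCocycle` with
the canonical-discretisation transfer of the flat-boundary class as an explicit hypothesis): pick a
chordal uniformizing map and the restriction data of the pulled-back hull, identify the SLE_{8/3}
avoidance number with `Φ_A'(0)^{5/8}` (step (c)) and feed the canonical transfer with the cocycle
of steps (a)+(b). [cite: LawlerSchrammWerner2003Restriction, Thm. 6.1 (p. 23)] -/
theorem avoidanceCocycle_of_canonicalTransfer : Summit.CriticalPhenomena.SAWScalingLimit.Theses.SAWDefectDecoherence.HexObservableLimitR → (∀ (D : Literature.Probability.RandomPlanarGeometry.DobrushinDomain) (ρ : ℝ) (Λ Λ' : ℝ → Finset Literature.Probability.LatticeModels.HexVertex) (m : ℝ → ℤ) (a : ℝ → Sym2 Literature.Probability.LatticeModels.HexVertex), 0 < ρ → D.carrier ∩ Metric.ball (D.pt 0) ρ = {z : ℂ | (D.pt 0).im < z.im} ∩ Metric.ball (D.pt 0) ρ → (∀ᶠ δ : ℝ in nhdsWithin (0 : ℝ) (Set.Ioi 0), Literature.Probability.RandomPlanarGeometry.SAW.hexDomainSimplyConnected (Λ δ) ∧ Literature.Probability.RandomPlanarGeometry.SAW.hexDomainSimplyConnected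 (Λ' δ) ∧ Λ' δ ⊆ Λ δ ∧ a δ ∈ Literature.Probability.RandomPlanarGeometry.SAW.hexDomainBoundary (Λ δ) ∧ a δ ∈ Literature.Probability.RandomPlanarGeometry.SAW.hexDomainBoundary (Λ' δ) ∧ (∀ v ∈ Λ δ, (δ : ℂ) * Literature.Probability.LatticeModels.hexCenter v ∈ D.carrier) ∧ (∀ v : Literature.Probability.LatticeModels.HexVertex, (δ : ℂ) * Literature.Probability.LatticeModels.hexCenter v ∈ Metric.ball (D.pt 0) ρ → (v ∈ Λ δ ↔ m δ ≤ v.1 1)) ∧ (∀ v : Literature.Probability.LatticeModels.HexVertex, (δ : ℂ) * Literature.Probability.LatticeModels.hexCenter v ∈ Metric.ball (D.pt 0) ρ → (v ∈ Λ' δ ↔ v ∈ Λ δ))) → Filter.Tendsto (fun δ : ℝ => (δ : ℂ) * Literature.Probability.RandomPlanarGeometry.SAW.hexMidpoint (a δ)) (nhdsWithin (0 : ℝ) (Set.Ioi 0)) (nhds (D.pt 0)) → ∀ ε : ℝ, 0 < ε → ∃ r₀ : ℝ, 0 < r₀ ∧ ∀ r : ℝ, 0 < r → r < r₀ → ∃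 ψ : ℂ → ℝ, Continuous ψ ∧ HasCompactSupport ψ ∧ (∀ z, 0 ≤ ψ z) ∧ (∃ z, ψ z ≠ 0) ∧ tsupport ψ ⊆ Metric.ball (D.pt 0 + (r : ℂ) * Complex.I) (r / 4) ∧ ∀ᶠ δ : ℝ in nhdsWithin (0 : ℝ) (Set.Ioi 0), ‖(∑ᶠ e ∈ Literature.Probability.RandomPlanarGeometry.SAW.hexDomainMidEdges (Λ' δ), (ψ ((δ : ℂ) * Literature.Probability.RandomPlanarGeometry.SAW.hexMidpoint e) : ℂ) * Literature.Probability.RandomPlanarGeometry.SAW.hexParafermionicObservable (Λ' δ) (a δ) Literature.Probability.RandomPlanarGeometry.SAW.hexCriticalFugacity (5 / 8) e) - ∑ᶠ e ∈ Literature.Probability.RandomPlanarGeometry.SAW.hexDomainMidEdges (Λ δ), (ψ ((δ : ℂ) * Literature.Probability.RandomPlanarGeometry.SAW.hexMidpoint e) : ℂ) * Literature.Probability.RandomPlanarGeometry.SAW.hexParafermionicObservable (Λ δ) (a δ) Literature.Probability.RandomPlanarGeometry.SAW.hexCriticalFugacity (5 / 8) e‖ ≤ ε * ‖∑ᶠ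 e ∈ Literature.Probability.RandomPlanarGeometry.SAW.hexDomainMidEdges (Λ δ), (ψ ((δ : ℂ) * Literature.Probability.RandomPlanarGeometry.SAW.hexMidpoint e) : ℂ) * Literature.Probability.RandomPlanarGeometry.SAW.hexParafermionicObservable (Λ δ) (a δ) Literature.Probability.RandomPlanarGeometry.SAW.hexCriticalFugacity (5 / 8) e‖) → ((∀ (D D' : Literature.Probability.RandomPlanarGeometry.DobrushinDomain) (ρ : ℝ) (φ : Literature.Probability.RandomPlanarGeometry.ConformalEquiv UpperHalfPlane.upperHalfPlaneSet D.carrier) (Φ : Literature.Probability.RandomPlanarGeometry.ConformalEquiv (UpperHalfPlane.upperHalfPlaneSet \ φ.pullbackHull D') UpperHalfPlane.upperHalfPlaneSet) (d : ℝ) (Λ Λ' : ℝ → Finset Literature.Probability.LatticeModels.HexVertex) (m : Fin 2 → ℝ → ℤ) (a b : ℝ → Sym2 Literature.Probability.LatticeModels.HexVertex), 0 < ρ → (∀ i : Fin 2, D.carrier ∩ Metric.ball (D.pt i) ρ = {z : ℂ | (D.pt i).im < z.im} ∩ Metric.ball (D.pt i) ρ) → D.IsHullSubdomain D' → D.IsChordalUniformizing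 φ → Literature.Probability.RandomPlanarGeometry.IsRestrictionMap (φ.pullbackHull D') Φ → Literature.Probability.RandomPlanarGeometry.HasRestrictionDeriv (φ.pullbackHull D') Φ d → (∀ᶠ δ : ℝ in nhdsWithin (0 : ℝ) (Set.Ioi 0), Λ' δ ⊆ Λ δ ∧ Literature.Probability.RandomPlanarGeometry.SAW.hexDomainSimplyConnected (Λ δ) ∧ Literature.Probability.RandomPlanarGeometry.SAW.hexDomainSimplyConnected (Λ' δ) ∧ (Literature.Probability.LatticeModels.hexGraph.induce ((Λ δ : Finset Literature.Probability.LatticeModels.HexVertex) : Set Literature.Probability.LatticeModels.HexVertex)).Preconnected ∧ (Literature.Probability.LatticeModels.hexGraph.induce ((Λ' δ : Finset Literature.Probability.LatticeModels.HexVertex) : Set Literature.Probability.LatticeModels.HexVertex)).Preconnected ∧ a δ ∈ Literature.Probability.RandomPlanarGeometry.SAW.hexDomainBoundary (Λ δ) ∧ b δ ∈ Literature.Probability.RandomPlanarGeometry.SAW.hexDomainBoundary (Λ δ) ∧ a δ ∈ Literature.Probability.RandomPlanarGeometry.SAW.hexDomainBoundary (Λ' δ) ∧ b δ ∈ Literature.Probability.RandomPlanarGeometry.SAW.hexDomainBoundary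 (Λ' δ) ∧ Nonempty (Literature.Probability.RandomPlanarGeometry.SAW.HexMidEdgeSAW (Λ' δ) (a δ) (b δ)) ∧ (∀ v ∈ Λ δ, (δ : ℂ) * Literature.Probability.LatticeModels.hexCenter v ∈ D.carrier) ∧ (∀ v ∈ Λ' δ, (δ : ℂ) * Literature.Probability.LatticeModels.hexCenter v ∈ D'.carrier) ∧ (∀ i : Fin 2, ∀ v : Literature.Probability.LatticeModels.HexVertex, (δ : ℂ) * Literature.Probability.LatticeModels.hexCenter v ∈ Metric.ball (D.pt i) ρ → ((v ∈ Λ δ ↔ m i δ ≤ v.1 1) ∧ (v ∈ Λ' δ ↔ m i δ ≤ v.1 1)))) → (∀ K : Set ℂ, IsCompact K → K ⊆ D.carrier → ∀ᶠ δ : ℝ in nhdsWithin (0 : ℝ) (Set.Ioi 0), ∀ v : Literature.Probability.LatticeModels.HexVertex, (δ : ℂ) * Literature.Probability.LatticeModels.hexCenter v ∈ K → v ∈ Λ δ) → (∀ K : Set ℂ, IsCompact K → K ⊆ D'.carrier → ∀ᶠ δ : ℝ in nhdsWithin (0 : ℝ) (Set.Ioi 0), ∀ v : Literature.Probability.LatticeModels.HexVertex,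 (δ : ℂ) * Literature.Probability.LatticeModels.hexCenter v ∈ K → v ∈ Λ' δ) → Filter.Tendsto (fun δ : ℝ => (δ : ℂ) * Literature.Probability.RandomPlanarGeometry.SAW.hexMidpoint (a δ)) (nhdsWithin (0 : ℝ) (Set.Ioi 0)) (nhds (D.pt 0)) → Filter.Tendsto (fun δ : ℝ => (δ : ℂ) * Literature.Probability.RandomPlanarGeometry.SAW.hexMidpoint (b δ)) (nhdsWithin (0 : ℝ) (Set.Ioi 0)) (nhds (D.pt 1)) → Filter.Tendsto (fun δ : ℝ => (∑ γ : Literature.Probability.RandomPlanarGeometry.SAW.HexMidEdgeSAW (Λ' δ) (a δ) (b δ), Literature.Probability.RandomPlanarGeometry.SAW.hexCriticalFugacity ^ γ.length) / (∑ γ : Literature.Probability.RandomPlanarGeometry.SAW.HexMidEdgeSAW (Λ δ) (a δ) (b δ), Literature.Probability.RandomPlanarGeometry.SAW.hexCriticalFugacity ^ γ.length)) (nhdsWithin (0 : ℝ) (Set.Ioi 0)) (nhds (d ^ ((5 : ℝ) / 8)))) → ∀ (D D' : Literature.Probability.RandomPlanarGeometry.DobrushinDomain) (ρ : ℝ) (φ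 : Literature.Probability.RandomPlanarGeometry.ConformalEquiv UpperHalfPlane.upperHalfPlaneSet D.carrier) (Φ : Literature.Probability.RandomPlanarGeometry.ConformalEquiv (UpperHalfPlane.upperHalfPlaneSet \ φ.pullbackHull D') UpperHalfPlane.upperHalfPlaneSet) (d : ℝ) (a b : ℝ → Literature.Probability.LatticeModels.HexVertex), 0 < ρ → (∀ i : Fin 2, D.carrier ∩ Metric.ball (D.pt i) ρ = {z : ℂ | (D.pt i).im < z.im} ∩ Metric.ball (D.pt i) ρ) → D.IsHullSubdomain D' → D.IsChordalUniformizing φ → Literature.Probability.RandomPlanarGeometry.IsRestrictionMap (φ.pullbackHull D') Φ → Literature.Probability.RandomPlanarGeometry.HasRestrictionDeriv (φ.pullbackHull D') Φ d → Literature.Probability.RandomPlanarGeometry.SAW.IsEmbEndpointApprox Literature.Probability.LatticeModels.hexGraph Literature.Probability.LatticeModels.hexCenter D a b → (∀ᶠ δ : ℝ in nhdsWithin (0 : ℝ) (Set.Ioi 0), (a δ ∈ Literature.Probability.RandomPlanarGeometry.SAW.embMeshDomain Literature.Probability.LatticeModels.hexGraph Literature.Probability.LatticeModels.hexCenter D.carrier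 δ ∧ ∃ w, Literature.Probability.LatticeModels.hexGraph.Adj (a δ) w ∧ ¬ (Literature.Probability.RandomPlanarGeometry.SAW.hexDomainGraph D.carrier δ).Adj (a δ) w) ∧ (b δ ∈ Literature.Probability.RandomPlanarGeometry.SAW.embMeshDomain Literature.Probability.LatticeModels.hexGraph Literature.Probability.LatticeModels.hexCenter D.carrier δ ∧ ∃ w, Literature.Probability.LatticeModels.hexGraph.Adj (b δ) w ∧ ¬ (Literature.Probability.RandomPlanarGeometry.SAW.hexDomainGraph D.carrier δ).Adj (b δ) w)) → Filter.Tendsto (fun δ : ℝ => ((Literature.Probability.RandomPlanarGeometry.SAW.hexSAWLaw D.carrier δ (a δ) (b δ)).map (fun γ : Literature.Probability.RandomPlanarGeometry.SAW.HexDomainSAW D.carrier δ (a δ) (b δ) => γ.curve)) (Literature.Probability.RandomPlanarGeometry.CurveClass.rangeSubset (closure D'.carrier))) (nhdsWithin (0 : ℝ) (Set.Ioi 0)) (nhds (ENNReal.ofReal (d ^ ((5 : ℝ) / 8))))) → ∀ (D D' : Literature.Probability.RandomPlanarGeometry.DobrushinDomain) (ρ : ℝ) (a b : ℝ → Literature.Probability.LatticeModels.HexVertex)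 (μ : MeasureTheory.Measure (Literature.Probability.RandomPlanarGeometry.CurveClass ℂ)), 0 < ρ → (∀ i : Fin 2, D.carrier ∩ Metric.ball (D.pt i) ρ = {z : ℂ | (D.pt i).im < z.im} ∩ Metric.ball (D.pt i) ρ) → Literature.Probability.RandomPlanarGeometry.SAW.IsEmbEndpointApprox Literature.Probability.LatticeModels.hexGraph Literature.Probability.LatticeModels.hexCenter D a b → (∀ᶠ δ : ℝ in nhdsWithin (0 : ℝ) (Set.Ioi 0), (a δ ∈ Literature.Probability.RandomPlanarGeometry.SAW.embMeshDomain Literature.Probability.LatticeModels.hexGraph Literature.Probability.LatticeModels.hexCenter D.carrier δ ∧ ∃ w, Literature.Probability.LatticeModels.hexGraph.Adj (a δ) w ∧ ¬ (Literature.Probability.RandomPlanarGeometry.SAW.hexDomainGraph D.carrier δ).Adj (a δ) w) ∧ (b δ ∈ Literature.Probability.RandomPlanarGeometry.SAW.embMeshDomain Literature.Probability.LatticeModels.hexGraph Literature.Probability.LatticeModels.hexCenter D.carrier δ ∧ ∃ w, Literature.Probability.LatticeModels.hexGraph.Adj (b δ) w ∧ ¬ (Literature.Probability.RandomPlanarGeometry.SAW.hexDomainGraph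 D.carrier δ).Adj (b δ) w)) → D.IsHullSubdomain D' → Literature.Probability.RandomPlanarGeometry.IsSLELaw ((8 : NNReal) / 3) D μ → Filter.Tendsto (fun δ : ℝ => ((Literature.Probability.RandomPlanarGeometry.SAW.hexSAWLaw D.carrier δ (a δ) (b δ)).map (fun γ : Literature.Probability.RandomPlanarGeometry.SAW.HexDomainSAW D.carrier δ (a δ) (b δ) => γ.curve)) (Literature.Probability.RandomPlanarGeometry.CurveClass.rangeSubset (closure D'.carrier))) (nhdsWithin (0 : ℝ) (Set.Ioi 0)) (nhds (μ (Literature.Probability.RandomPlanarGeometry.CurveClass.rangeSubset (closure D'.carrier)))) := by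
  intro hO hRD hCT D D' ρ a b μ hρ hflat hab hbd hD' hμ
  obtain ⟨φ, Φ, d, hφ, hΦ, hd, -, -⟩ := stub_avoidanceCocycle_restrictionData D D' hD'
  rw [measure_rangeSubset_closure_eq_of_isSLELaw hμ hD' hφ hΦ hd]
  exact hCT (restrictionLimit_of_rootDominance hO hRD) D D' ρ φ Φ d a b hρ hflat hD' hφ hΦ hd hab hbd


/-- **Registered helper `stub_avoidanceCocycle_floorEndpoint`** (crux item stmt-CriticalPhenomena-0808,
line `root-locality-replaces-loewner`, stub `stub_avoidanceCocycle`): inside a flat ball a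
DISCRETE-BOUNDARY vertex of `Ω_δ` (a honeycomb neighbour `w` with the `Ω_δ`-edge missing) is a FLOOR
vertex: that neighbour lies on or below the floor line (otherwise the segment to it stays in the
flat half-disc, is a mesh edge, and drags `w` into the component `Ω_δ`). [folklore] -/
theorem stub_avoidanceCocycle_floorEndpoint : ∀ (Ω : Set ℂ) (p : ℂ) (ρ δ : ℝ) (a w : Literature.Probability.LatticeModels.HexVertex), Ω ∩ Metric.ball p ρ = {z : ℂ | p.im < z.im} ∩ Metric.ball p ρ → (δ : ℂ) * Literature.Probability.LatticeModels.hexCenter a ∈ Metric.ball p ρ → (δ : ℂ) * Literature.Probability.LatticeModels.hexCenter w ∈ Metric.ball p ρ → a ∈ Literature.Probability.RandomPlanarGeometry.SAW.embMeshDomain Literature.Probability.LatticeModels.hexGraph Literature.Probability.LatticeModels.hexCenter Ω δ → Literature.Probability.LatticeModels.hexGraph.Adj a w → ¬ (Literature.Probability.RandomPlanarGeometry.SAW.hexDomainGraph Ω δ).Adj a w → ((δ : ℂ) * Literature.Probability.LatticeModels.hexCenter w).im ≤ p.im := by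
  intro Ω p ρ δ a w hflat ha hw haΩ hadj hnot
  by_contra hlt
  push Not at hlt
  apply hnot
  have haΩ' : (δ : ℂ) * hexCenter a ∈ Ω := embMeshDomain_subset _ _ _ _ haΩ
  have haim : p.im < ((δ : ℂ) * hexCenter a).im := by
    have : (δ : ℂ) * hexCenter a ∈ Ω ∩ ball p ρ := ⟨haΩ', ha⟩
    rw [hflat] at this
    exact this.1
  have hwΩ : (δ : ℂ) * hexCenter w ∈ Ω := mem_of_floor hflat le_rfl ⟨hlt, hw⟩
  have hseg : segment ℝ ((δ : ℂ) * hexCenter a) ((δ : ℂ) * hexCenter w) ⊆ closure Ω :=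
    (segment_subset_of_floor (p := p) (r := ρ) ⟨haim, ha⟩ ⟨hlt, hw⟩).trans
      fun z hz => subset_closure (mem_of_floor hflat le_rfl hz)
  have hmesh : (embMeshGraph hexGraph hexCenter Ω δ).Adj a w :=
    (embMeshGraph_adj_iff _ _).2 ⟨hadj, hseg⟩
  exact (embDomainGraph_adj_iff _ _).2 ⟨hmesh, haΩ, mem_embMeshDomain_of_adj haΩ hwΩ hmesh⟩

/-- **Crux-10472's admissible restriction limit from ROOT DOMINANCE** (instead of short-chord
locality): `HexObservableLimitR → RootDominance → AdmissibleRestrictionLimit`, the latter verbatim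
the hypothesis of the landed `FloorRatio.canonicalTransfer_of_hullApprox` (floor class, one row
function) — a specialisation of the flat-class `restrictionLimit_of_rootDominance`.
[cite: LawlerSchrammWerner2004SAW, §3.4 ("SAW satisfies restriction") and Prop. 2] -/
theorem admissibleRestrictionLimit_of_rootDominance
    (hO : Summit.CriticalPhenomena.SAWScalingLimit.Theses.SAWDefectDecoherence.HexObservableLimitR)
    (hRD : ∀ (D : Literature.Probability.RandomPlanarGeometry.DobrushinDomain) (ρ : ℝ) (Λ Λ' : ℝ → Finset Literature.Probability.LatticeModels.HexVertex) (m : ℝ → ℤ) (a : ℝ → Sym2 Literature.Probability.LatticeModels.HexVertex), 0 < ρ → D.carrier ∩ Metric.ball (D.pt 0) ρ = {z : ℂ | (D.pt 0).im < z.im} ∩ Metric.ball (D.pt 0) ρ → (∀ᶠ δ : ℝ in nhdsWithin (0 : ℝ) (Set.Ioi 0), Literature.Probability.RandomPlanarGeometry.SAW.hexDomainSimplyConnected (Λ δ) ∧ Literature.Probability.RandomPlanarGeometry.SAW.hexDomainSimplyConnected (Λ' δ) ∧ Λ' δ ⊆ Λ δ ∧ a δ ∈ Literature.Probability.RandomPlanarGeometry.SAW.hexDomainBoundary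 (Λ δ) ∧ a δ ∈ Literature.Probability.RandomPlanarGeometry.SAW.hexDomainBoundary (Λ' δ) ∧ (∀ v ∈ Λ δ, (δ : ℂ) * Literature.Probability.LatticeModels.hexCenter v ∈ D.carrier) ∧ (∀ v : Literature.Probability.LatticeModels.HexVertex, (δ : ℂ) * Literature.Probability.LatticeModels.hexCenter v ∈ Metric.ball (D.pt 0) ρ → (v ∈ Λ δ ↔ m δ ≤ v.1 1)) ∧ (∀ v : Literature.Probability.LatticeModels.HexVertex, (δ : ℂ) * Literature.Probability.LatticeModels.hexCenter v ∈ Metric.ball (D.pt 0) ρ → (v ∈ Λ' δ ↔ v ∈ Λ δ))) → Filter.Tendsto (fun δ : ℝ => (δ : ℂ) * Literature.Probability.RandomPlanarGeometry.SAW.hexMidpoint (a δ)) (nhdsWithin (0 : ℝ) (Set.Ioi 0)) (nhds (D.pt 0)) → ∀ ε : ℝ, 0 < ε → ∃ r₀ : ℝ, 0 < r₀ ∧ ∀ r : ℝ, 0 < r → r < r₀ → ∃ ψ : ℂ → ℝ, Continuous ψ ∧ HasCompactSupport ψ ∧ (∀ z, 0 ≤ ψ z) ∧ (∃ z, ψ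 z ≠ 0) ∧ tsupport ψ ⊆ Metric.ball (D.pt 0 + (r : ℂ) * Complex.I) (r / 4) ∧ ∀ᶠ δ : ℝ in nhdsWithin (0 : ℝ) (Set.Ioi 0), ‖(∑ᶠ e ∈ Literature.Probability.RandomPlanarGeometry.SAW.hexDomainMidEdges (Λ' δ), (ψ ((δ : ℂ) * Literature.Probability.RandomPlanarGeometry.SAW.hexMidpoint e) : ℂ) * Literature.Probability.RandomPlanarGeometry.SAW.hexParafermionicObservable (Λ' δ) (a δ) Literature.Probability.RandomPlanarGeometry.SAW.hexCriticalFugacity (5 / 8) e) - ∑ᶠ e ∈ Literature.Probability.RandomPlanarGeometry.SAW.hexDomainMidEdges (Λ δ), (ψ ((δ : ℂ) * Literature.Probability.RandomPlanarGeometry.SAW.hexMidpoint e) : ℂ) * Literature.Probability.RandomPlanarGeometry.SAW.hexParafermionicObservable (Λ δ) (a δ) Literature.Probability.RandomPlanarGeometry.SAW.hexCriticalFugacity (5 / 8) e‖ ≤ ε * ‖∑ᶠ e ∈ Literature.Probability.RandomPlanarGeometry.SAW.hexDomainMidEdges (Λ δ), (ψ ((δ : ℂ) * Literature.Probability.RandomPlanarGeometry.SAW.hexMidpoint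 e) : ℂ) * Literature.Probability.RandomPlanarGeometry.SAW.hexParafermionicObservable (Λ δ) (a δ) Literature.Probability.RandomPlanarGeometry.SAW.hexCriticalFugacity (5 / 8) e‖) :
    
    ∀ (D D' : DobrushinDomain) (ρ : ℝ) (φ : ConformalEquiv upperHalfPlaneSet D.carrier)
    (Φ : ConformalEquiv (upperHalfPlaneSet \ φ.pullbackHull D') upperHalfPlaneSet) (d : ℝ)
    (Λ Λ' : ℝ → Finset HexVertex) (m : ℝ → ℤ) (a b : ℝ → Sym2 HexVertex),
    (0 < ρ ∧ (D.pt 1).im = (D.pt 0).im ∧ D.carrier ⊆ {z : ℂ | (D.pt 0).im < z.im} ∧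
    D.carrier ∩ ball (D.pt 0) ρ = {z : ℂ | (D.pt 0).im < z.im} ∩ ball (D.pt 0) ρ ∧
    D.carrier ∩ ball (D.pt 1) ρ = {z : ℂ | (D.pt 1).im < z.im} ∩ ball (D.pt 1) ρ) → D.IsHullSubdomain D' → D.IsChordalUniformizing φ →
    IsRestrictionMap (φ.pullbackHull D') Φ → HasRestrictionDeriv (φ.pullbackHull D') Φ d →
    (∀ᶠ δ : ℝ in 𝓝[>] 0,
    Λ' δ ⊆ Λ δ ∧ hexDomainSimplyConnected (Λ δ) ∧ hexDomainSimplyConnected (Λ' δ) ∧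
    (hexGraph.induce (↑(Λ δ) : Set HexVertex)).Preconnected ∧
    (hexGraph.induce (↑(Λ' δ) : Set HexVertex)).Preconnected ∧
    a δ ∈ hexDomainBoundary (Λ δ) ∧ b δ ∈ hexDomainBoundary (Λ δ) ∧
    a δ ∈ hexDomainBoundary (Λ' δ) ∧ b δ ∈ hexDomainBoundary (Λ' δ) ∧
    Nonempty (HexMidEdgeSAW (Λ' δ) (a δ) (b δ)) ∧
    (∀ v ∈ Λ δ, (δ : ℂ) * hexCenter v ∈ D.carrier ∧ m δ ≤ v.1 1) ∧
    (∀ v ∈ Λ' δ, (δ : ℂ) * hexCenter v ∈ D'.carrier) ∧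
    (∀ v : HexVertex, (δ : ℂ) * hexCenter v ∈ ball (D.pt 0) ρ ∪ ball (D.pt 1) ρ →
    ((v ∈ Λ δ ↔ m δ ≤ v.1 1) ∧ (v ∈ Λ' δ ↔ m δ ≤ v.1 1)))) →
    (∀ K : Set ℂ, IsCompact K → K ⊆ D.carrier →
    ∀ᶠ δ : ℝ in 𝓝[>] 0, ∀ v : HexVertex, (δ : ℂ) * hexCenter v ∈ K → v ∈ Λ δ) →
    (∀ K : Set ℂ, IsCompact K → K ⊆ D'.carrier →
    ∀ᶠ δ : ℝ in 𝓝[>] 0, ∀ v : HexVertex, (δ : ℂ) * hexCenter v ∈ K → v ∈ Λ' δ) →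
    Tendsto (fun δ : ℝ => (δ : ℂ) * hexMidpoint (a δ)) (𝓝[>] 0) (𝓝 (D.pt 0)) →
    Tendsto (fun δ : ℝ => (δ : ℂ) * hexMidpoint (b δ)) (𝓝[>] 0) (𝓝 (D.pt 1)) →
    Tendsto (fun δ : ℝ => (∑ γ : HexMidEdgeSAW (Λ' δ) (a δ) (b δ), hexCriticalFugacity ^ γ.length) /
    (∑ γ : HexMidEdgeSAW (Λ δ) (a δ) (b δ), hexCriticalFugacity ^ γ.length)) (𝓝[>] 0)
    (𝓝 (d ^ ((5 : ℝ) / 8))) := by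
  intro D₁ D₁' ρ₁ φ Φ d Λ Λ' m a₁ b₁ hfl₁ hD₁' hφ hΦ hd hadm hK hK' ha hb
  obtain ⟨hρ₁, -, -, hf0, hf1⟩ := hfl₁
  refine restrictionLimit_of_rootDominance hO hRD D₁ D₁' ρ₁ φ Φ d Λ Λ' (fun _ => m) a₁ b₁ hρ₁
    (Fin.forall_fin_two.2 ⟨hf0, hf1⟩) hD₁' hφ hΦ hd ?_ hK hK' ha hb
  filter_upwards [hadm] with δ h
  obtain ⟨h1, h2, h3, h4, h5, h6, h7, h8, h9, h10, h11, h12, h13⟩ := h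
  exact ⟨h1, h2, h3, h4, h5, h6, h7, h8, h9, h10, fun v hv => (h11 v hv).1, h12,
    Fin.forall_fin_two.2 ⟨fun v hv => h13 v (Or.inl hv), fun v hv => h13 v (Or.inr hv)⟩⟩

/-- **The avoidance cocycle in the FLOOR class, modulo (HA).**  See the module docstring.
[cite: LawlerSchrammWerner2004SAW, §3.4 ("SAW satisfies restriction") and Prop. 2] -/
theorem hexAvoidanceCocycle_floor_of_hullApprox
    (hO : Summit.CriticalPhenomena.SAWScalingLimit.Theses.SAWDefectDecoherence.HexObservableLimitR)
    (hRD : ∀ (D : Literature.Probability.RandomPlanarGeometry.DobrushinDomain) (ρ : ℝ) (Λ Λ' : ℝ → Finset Literature.Probability.LatticeModels.HexVertex) (m : ℝ → ℤ) (a : ℝ → Sym2 Literature.Probability.LatticeModels.HexVertex), 0 < ρ → D.carrier ∩ Metric.ball (D.pt 0) ρ = {z : ℂ | (D.pt 0).im < z.im} ∩ Metric.ball (D.pt 0) ρ → (∀ᶠ δ : ℝ in nhdsWithin (0 : ℝ) (Set.Ioi 0), Literature.Probability.RandomPlanarGeometry.SAW.hexDomainSimplyConnected (Λ δ) ∧ Literature.Probability.RandomPlanarGeometry.SAW.hexDomainSimplyConnected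 (Λ' δ) ∧ Λ' δ ⊆ Λ δ ∧ a δ ∈ Literature.Probability.RandomPlanarGeometry.SAW.hexDomainBoundary (Λ δ) ∧ a δ ∈ Literature.Probability.RandomPlanarGeometry.SAW.hexDomainBoundary (Λ' δ) ∧ (∀ v ∈ Λ δ, (δ : ℂ) * Literature.Probability.LatticeModels.hexCenter v ∈ D.carrier) ∧ (∀ v : Literature.Probability.LatticeModels.HexVertex, (δ : ℂ) * Literature.Probability.LatticeModels.hexCenter v ∈ Metric.ball (D.pt 0) ρ → (v ∈ Λ δ ↔ m δ ≤ v.1 1)) ∧ (∀ v : Literature.Probability.LatticeModels.HexVertex, (δ : ℂ) * Literature.Probability.LatticeModels.hexCenter v ∈ Metric.ball (D.pt 0) ρ → (v ∈ Λ' δ ↔ v ∈ Λ δ))) → Filter.Tendsto (fun δ : ℝ => (δ : ℂ) * Literature.Probability.RandomPlanarGeometry.SAW.hexMidpoint (a δ)) (nhdsWithin (0 : ℝ) (Set.Ioi 0)) (nhds (D.pt 0)) → ∀ ε : ℝ, 0 < ε → ∃ r₀ : ℝ, 0 < r₀ ∧ ∀ r : ℝ, 0 < r → r < r₀ → ∃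 ψ : ℂ → ℝ, Continuous ψ ∧ HasCompactSupport ψ ∧ (∀ z, 0 ≤ ψ z) ∧ (∃ z, ψ z ≠ 0) ∧ tsupport ψ ⊆ Metric.ball (D.pt 0 + (r : ℂ) * Complex.I) (r / 4) ∧ ∀ᶠ δ : ℝ in nhdsWithin (0 : ℝ) (Set.Ioi 0), ‖(∑ᶠ e ∈ Literature.Probability.RandomPlanarGeometry.SAW.hexDomainMidEdges (Λ' δ), (ψ ((δ : ℂ) * Literature.Probability.RandomPlanarGeometry.SAW.hexMidpoint e) : ℂ) * Literature.Probability.RandomPlanarGeometry.SAW.hexParafermionicObservable (Λ' δ) (a δ) Literature.Probability.RandomPlanarGeometry.SAW.hexCriticalFugacity (5 / 8) e) - ∑ᶠ e ∈ Literature.Probability.RandomPlanarGeometry.SAW.hexDomainMidEdges (Λ δ), (ψ ((δ : ℂ) * Literature.Probability.RandomPlanarGeometry.SAW.hexMidpoint e) : ℂ) * Literature.Probability.RandomPlanarGeometry.SAW.hexParafermionicObservable (Λ δ) (a δ) Literature.Probability.RandomPlanarGeometry.SAW.hexCriticalFugacity (5 / 8) e‖ ≤ ε * ‖∑ᶠ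 e ∈ Literature.Probability.RandomPlanarGeometry.SAW.hexDomainMidEdges (Λ δ), (ψ ((δ : ℂ) * Literature.Probability.RandomPlanarGeometry.SAW.hexMidpoint e) : ℂ) * Literature.Probability.RandomPlanarGeometry.SAW.hexParafermionicObservable (Λ δ) (a δ) Literature.Probability.RandomPlanarGeometry.SAW.hexCriticalFugacity (5 / 8) e‖)
    (HA : ∀ (D D' : DobrushinDomain), D.IsHullSubdomain D' →
      ∀ (φ : ConformalEquiv upperHalfPlaneSet D.carrier)
      (Φ : ConformalEquiv (upperHalfPlaneSet \ φ.pullbackHull D') upperHalfPlaneSet) (d : ℝ),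
      D.IsChordalUniformizing φ → IsRestrictionMap (φ.pullbackHull D') Φ →
      HasRestrictionDeriv (φ.pullbackHull D') Φ d →
      ∀ ε : ℝ, 0 < ε → ∃ (D'' : DobrushinDomain)
        (Φ'' : ConformalEquiv (upperHalfPlaneSet \ φ.pullbackHull D'') upperHalfPlaneSet) (d'' η : ℝ),
        D.IsHullSubdomain D'' ∧ D'.carrier ⊆ D''.carrier ∧ 0 < η ∧
        (∀ z ∈ D.carrier, Metric.infDist z D'.carrier ≤ η → z ∈ D''.carrier) ∧
        IsRestrictionMap (φ.pullbackHull D'') Φ'' ∧ HasRestrictionDeriv (φ.pullbackHull D'') Φ'' d'' ∧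
        d'' ^ ((5 : ℝ) / 8) ≤ (1 + ε) * d ^ ((5 : ℝ) / 8)) :
    ∀ (D D' : DobrushinDomain) (ρ : ℝ) (a b : ℝ → HexVertex) (μ : Measure (CurveClass ℂ)),
      (0 < ρ ∧ (D.pt 1).im = (D.pt 0).im ∧ D.carrier ⊆ {z : ℂ | (D.pt 0).im < z.im} ∧
        D.carrier ∩ ball (D.pt 0) ρ = {z : ℂ | (D.pt 0).im < z.im} ∩ ball (D.pt 0) ρ ∧
        D.carrier ∩ ball (D.pt 1) ρ = {z : ℂ | (D.pt 1).im < z.im} ∩ ball (D.pt 1) ρ) →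
      IsEmbEndpointApprox hexGraph hexCenter D a b →
      (∀ᶠ δ : ℝ in 𝓝[>] 0,
        (a δ ∈ embMeshDomain hexGraph hexCenter D.carrier δ ∧
          ∃ w, hexGraph.Adj (a δ) w ∧ ¬ (hexDomainGraph D.carrier δ).Adj (a δ) w) ∧
        (b δ ∈ embMeshDomain hexGraph hexCenter D.carrier δ ∧
          ∃ w, hexGraph.Adj (b δ) w ∧ ¬ (hexDomainGraph D.carrier δ).Adj (b δ) w)) →
      D.IsHullSubdomain D' → IsSLELaw ((8 : ℝ≥0) / 3) D μ →
      Tendsto (fun δ : ℝ =>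
        ((hexSAWLaw D.carrier δ (a δ) (b δ)).map
            (fun γ : HexDomainSAW D.carrier δ (a δ) (b δ) => γ.curve))
          (CurveClass.rangeSubset (closure D'.carrier)))
        (𝓝[>] 0) (𝓝 (μ (CurveClass.rangeSubset (closure D'.carrier)))) := by
  intro D D' ρ a b μ hfl hab hbd hD' hμ
  obtain ⟨hρ, hpt, hDh, hflat0, hflat1⟩ := hfl
  -- (1) the admissible cocycle of crux 10472 from steps (a)+(b)
  have hFRL := canonicalTransfer_of_hullApprox HA (admissibleRestrictionLimit_of_rootDominance hO hRD)
  -- (2) restriction data and the value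
  obtain ⟨φ, Φ, d, hφ, hΦ, hd, hd0, hd1⟩ := stub_avoidanceCocycle_restrictionData D D' hD'
  rw [measure_rangeSubset_closure_eq_of_isSLELaw hμ hD' hφ hΦ hd]
  -- (3) the endpoints are floor vertices
  have hend : IsEmbEndpointApprox hexGraph hexCenter D a b ∧ ∀ᶠ δ : ℝ in 𝓝[>] 0,
      (∃ u : HexVertex, hexGraph.Adj (a δ) u ∧ ((δ : ℂ) * hexCenter u).im ≤ (D.pt 0).im) ∧
      (∃ u : HexVertex, hexGraph.Adj (b δ) u ∧ ((δ : ℂ) * hexCenter u).im ≤ (D.pt 1).im) := by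
    refine ⟨hab, ?_⟩
    filter_upwards [hbd, eventually_adj_mem_ball hρ hab.tendsto_fst,
      eventually_adj_mem_ball hρ hab.tendsto_snd] with δ h hBa hBb
    obtain ⟨⟨haΩ, wa, hwa, hna⟩, ⟨hbΩ, wb, hwb, hnb⟩⟩ := h
    exact ⟨⟨wa, hwa, stub_avoidanceCocycle_floorEndpoint _ _ _ _ _ _ hflat0 (hBa _ (Or.inl rfl))
        (hBa _ (Or.inr hwa)) haΩ hwa hna⟩,
      ⟨wb, hwb, stub_avoidanceCocycle_floorEndpoint _ _ _ _ _ _ hflat1 (hBb _ (Or.inl rfl))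
        (hBb _ (Or.inr hwb)) hbΩ hwb hnb⟩⟩
  -- (4) the events
  set P : ℝ → ℝ≥0∞ := fun δ => ((hexSAWLaw D.carrier δ (a δ) (b δ)).map
      (fun γ : HexDomainSAW D.carrier δ (a δ) (b δ) => γ.curve))
    (CurveClass.rangeSubset (closure D'.carrier)) with hP
  have hPeq : ∀ δ, P δ = hexSAWLaw D.carrier δ (a δ) (b δ)
      {γ | γ.curve ∈ CurveClass.rangeSubset (closure D'.carrier)} := fun δ =>
    Measure.map_apply (EmbDomainSAW.measurable_of_top _)
      (CurveClass.measurableSet_rangeSubset isClosed_closure)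
  set M : ∀ (D'' : DobrushinDomain) (δ : ℝ), Set (HexDomainSAW D.carrier δ (a δ) (b δ)) :=
    fun D'' δ =>
    {γ : HexDomainSAW D.carrier δ (a δ) (b δ) |
      (∀ v ∈ γ.walk.support, v ∈ embMeshVertices hexCenter D''.carrier δ) ∧
      ∀ e ∈ γ.walk.darts, (embMeshGraph hexGraph hexCenter D''.carrier δ).Adj e.fst e.snd}
    with hM
  -- lower inclusion: `D'`-mesh walks stay in `closure D'`
  have hlow : ∀ δ, M D' δ ⊆ {γ | γ.curve ∈ CurveClass.rangeSubset (closure D'.carrier)} :=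
    fun δ γ hγ => curve_mem_rangeSubset_of_meshWalk γ hγ.1 hγ.2
  -- upper inclusion: walks in `closure D'` are `D''`-mesh walks for `D'' ⊇ collar (D')`
  have hup : ∀ (D'' : DobrushinDomain) (η : ℝ), 0 < η → D'.carrier ⊆ D''.carrier →
      (∀ z ∈ D.carrier, Metric.infDist z D'.carrier ≤ η → z ∈ D''.carrier) → ∀ δ,
      a δ ≠ b δ → {γ | γ.curve ∈ CurveClass.rangeSubset (closure D'.carrier)} ⊆ M D'' δ := by
    intro D'' η hη hsub'' hcol δ hne γ hγ
    have hrange : Set.range (γ.walk.toCurve fun v => (δ : ℂ) * hexCenter v) ⊆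
        closure D'.carrier := hγ
    have hclD'' : ∀ z ∈ D.carrier, z ∈ closure D'.carrier → z ∈ D''.carrier := fun z hz hzc =>
      hcol z hz (by rw [Metric.infDist_zero_of_mem_closure hzc]; exact hη.le)
    have hvert : ∀ v ∈ γ.walk.support, v ∈ embMeshVertices hexCenter D''.carrier δ := by
      intro v hv
      have hvΩ : v ∈ embMeshDomain hexGraph hexCenter D.carrier δ :=
        support_subset_embMeshDomain_of_ne γ hne v hv
      exact hclD'' _ (embMeshDomain_subset _ _ _ _ hvΩ)
        (hrange (SimpleGraph.Walk.mem_range_toCurve _ _ hv))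
    refine ⟨hvert, fun e he => (embMeshGraph_adj_iff _ _).2 ⟨?_, ?_⟩⟩
    · exact embDomainGraph_le _ _ _ _ e.adj
    · exact ((segment_subset_range_toCurve _ γ.walk e he).trans hrange).trans
        (closure_mono hsub'')
  -- (5) the squeeze, in `ℝ`
  have hc1 : d ^ ((5 : ℝ) / 8) ≤ 1 := Real.rpow_le_one hd0.le hd1 (by norm_num)
  have hc0 : 0 ≤ d ^ ((5 : ℝ) / 8) := Real.rpow_nonneg hd0.le _
  have hTlow := hFRL D D' ρ φ Φ d a b ⟨hρ, hpt, hDh, hflat0, hflat1⟩ hD' hφ hΦ hd hend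
  have hne : ∀ᶠ δ : ℝ in 𝓝[>] 0, a δ ≠ b δ :=
    eventually_ne_of_tendsto_hexCenter (D.pt_injective.ne (by decide)) hab.tendsto_fst hab.tendsto_snd
  have hprob := eventually_isProbabilityMeasure_hexSAWLaw hab
  have hreal : Tendsto (fun δ => (P δ).toReal) (𝓝[>] 0) (𝓝 (d ^ ((5 : ℝ) / 8))) := by
    refine tendsto_of_eventually_between fun ε hε => ?_
    obtain ⟨D'', Φ'', d'', η, hD'', hsub'', hη, hcol, hΦ'', hd'', hbound⟩ :=
      HA D D' hD' φ Φ d hφ hΦ hd (ε / 2) (half_pos hε)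
    have hTup := hFRL D D'' ρ φ Φ'' d'' a b ⟨hρ, hpt, hDh, hflat0, hflat1⟩ hD'' hφ hΦ'' hd'' hend
    refine ⟨d ^ ((5 : ℝ) / 8) - ε / 2, d'' ^ ((5 : ℝ) / 8) + ε / 4, by linarith, ?_, ?_⟩
    · nlinarith
    · filter_upwards [Metric.tendsto_nhds.1 hTlow (ε / 2) (half_pos hε),
        Metric.tendsto_nhds.1 hTup (ε / 4) (by positivity), hne, hprob] with δ h1 h2 hneδ hPδ
      rw [Real.dist_eq] at h1 h2
      obtain ⟨h1a, -⟩ := abs_lt.1 h1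
      obtain ⟨-, h2b⟩ := abs_lt.1 h2
      haveI := hPδ
      have hm1 : ((hexSAWLaw D.carrier δ (a δ) (b δ)) (M D' δ)).toReal ≤ (P δ).toReal := by
        rw [hPeq]; exact ENNReal.toReal_mono (measure_ne_top _ _) (measure_mono (hlow δ))
      have hm2 : (P δ).toReal ≤ ((hexSAWLaw D.carrier δ (a δ) (b δ)) (M D'' δ)).toReal := by
        rw [hPeq]
        exact ENNReal.toReal_mono (measure_ne_top _ _)
          (measure_mono (hup D'' η hη hsub'' hcol δ hneδ))
      constructor <;> linarith
  -- back to `ℝ≥0∞`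
  have hfin : ∀ᶠ δ : ℝ in 𝓝[>] 0, P δ ≠ ⊤ := hprob.mono fun δ hPδ => by
    haveI := hPδ
    rw [hPeq]; exact measure_ne_top _ _
  refine (ENNReal.tendsto_ofReal hreal).congr' ?_
  filter_upwards [hfin] with δ hδ
  exact ENNReal.ofReal_toReal hδ


end Summit.CriticalPhenomena.SAWScalingLimit.Theorems.HexConjecture.RootLocality

end
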